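import Literature.AlgebraicGeometry.HodgeTheory.CyclicCoverReflectionMonodromy
import Literature.AlgebraicGeometry.HodgeTheory.HypersurfaceJacobian
import Literature.AlgebraicGeometry.HodgeTheory.HypersurfaceCutOutByLefschetz
import Literature.AlgebraicGeometry.HodgeTheory.OddHypersurfaceHodgeConjecture
import Literature.AlgebraicGeometry.Motives.ProjectiveSpaceFieldPoints
import Literature.AlgebraicGeometry.Motives.GeneralNonsingularForms
import Literature.NumberTheory.Transcendental.RoySmallValueFactors
import Mathlib.FieldTheory.IsAlgClosed.Basic
import Mathlib.Algebra.MvPolynomial.Funext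
import HarnessLib

/-!
# Smooth cyclic covers `x₃^p = f` of the plane: the cyclic cover form is a NONSINGULAR FORM

Family `hodge`, layer `Literature/AlgebraicGeometry/HodgeTheory`; theorems only (no definition, no named
fact). For the models `X_F = SmoothHypersurface.hypersurface (cyclicCoverForm p f)`, `F = x₃^p − f(x₀,x₁,x₂)`
(`HodgeTheory/CyclicCoverReflectionMonodromy`), with `f ≠ 0` homogeneous of degree `p ≥ 2` and `X_F` smooth
projective — the hypotheses under which the cited fact `nonempty_carlsonToledoFamily` and the Carlson–Toledo
Hodge-number facts quantify — this file proves, AT LITERATURE LEVEL (so that the construction of the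
Carlson–Toledo universal family `HodgeTheory/CyclicCoverUniversalFamily` can classify every such `f` by a point
of the open set `U` of nonsingular quaternary `p`-forms):

* `isNonsingularForm_cyclicCoverForm_of_isSmoothProjective` — **`F` is a nonsingular form** (Jacobian
  criterion: `F` and its partials have no common non-zero zero), and
  `exists_eval_pderiv_cyclicCoverForm_ne_zero` — the gradient form of the same statement.

The proof is the one landed by the prover seat `hodge-nonav-prover-A` under
`Summits/HodgeConjecture/HodgeConjecture/Theorems/CyclicUnitaryPowersCyclicCoverIrreducible.lean` (which a
Literature file may not import); its lemmas are reproduced here as PRIVATE declarations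
(`-- adapted from Summits/…/CyclicUnitaryPowersCyclicCoverIrreducible.lean`):
§1 `ℂ[x₀,…,x₃] ≅ ℂ[x₀,x₁,x₂][x₃]` (`F ↦ X^p − C f`); §2 `F` is irreducible (`X_F` irreducible ⇒
`V₊(F) = V₊(g)`, `F = g·h`, and a positive `x₃`-degree of `h` would force `f = 0`); §3 the Jacobian criterion
`Hartshorne1977_smoothHypersurface_jacobian_holds` for the irreducible `F`, and Hilbert's Nullstellensatz half
`isNonsingularForm_of_forall_exists_eval_pderiv_ne_zero`.

## References

* [Hartshorne1977] R. Hartshorne, Algebraic Geometry, GTM 52 (1977), I Thm. 5.1, I Ex. 2.9, I Ex. 5.8,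
  II Ex. 2.9, III Example 10.0.3.
* [CarlsonToledo1999] J. A. Carlson, D. Toledo, Discriminant complements and kernels of monodromy
  representations, Duke Math. J. 97 (1999), §2.
-/

noncomputable section

namespace Literature.AlgebraicGeometry.HodgeTheory

namespace CyclicCoverFormNonsingular

-- adapted from Summits/HodgeConjecture/HodgeConjecture/Theorems/CyclicUnitaryPowersCyclicCoverIrreducible.lean
-- (prover seat hodge-nonav-prover-A); private, so that the Summits originals remain the citable versions there.

open scoped Polynomial
open Literature.AlgebraicGeometry.Motives Literature.AlgebraicGeometry.HodgeTheory
open CategoryTheory MvPolynomial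

/-! ### §1 `ℂ[x₀,x₁,x₂,x₃] = ℂ[x₀,x₁,x₂][x₃]`: the cyclic cover form is the monic binomial `X^p − f` -/

section LastVariable

/-! Throughout, `Ψ G := optionEquivLeft ℂ (Fin 3) (rename finSuccEquivLast G)` (Mathlib: single out the
LAST variable as the polynomial variable); it is an algebra isomorphism, written out in full. -/

/-- `Ψ x₃ = X`. [folklore] -/
private theorem psi_X_last : MvPolynomial.optionEquivLeft ℂ (Fin 3)
      (rename finSuccEquivLast (X (Fin.last 3) : MvPolynomial (Fin 4) ℂ)) = Polynomial.X := by
  rw [rename_X, finSuccEquivLast_last, MvPolynomial.optionEquivLeft_X_none]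

/-- `Ψ xᵢ = C yᵢ` for `i < 3`. [folklore] -/
private theorem psi_X_castSucc (i : Fin 3) : MvPolynomial.optionEquivLeft ℂ (Fin 3)
      (rename finSuccEquivLast (X (Fin.castSucc i) : MvPolynomial (Fin 4) ℂ)) = Polynomial.C (X i) := by
  rw [rename_X, finSuccEquivLast_castSucc, MvPolynomial.optionEquivLeft_X_some]

/-- `Ψ (C r) = C (C r)`. [folklore] -/
private theorem psi_C (r : ℂ) : MvPolynomial.optionEquivLeft ℂ (Fin 3)
      (rename finSuccEquivLast (C r : MvPolynomial (Fin 4) ℂ)) = Polynomial.C (C r) := by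
  rw [rename_C, MvPolynomial.optionEquivLeft_C]

/-- `Ψ` of a polynomial in `x₀, x₁, x₂` only is the constant `C f` of `ℂ[y][x₃]`. [folklore] -/
private theorem psi_rename_castSucc (f : MvPolynomial (Fin 3) ℂ) : MvPolynomial.optionEquivLeft ℂ (Fin 3)
      (rename finSuccEquivLast (rename Fin.castSucc f : MvPolynomial (Fin 4) ℂ)) = Polynomial.C f := by
  induction f using MvPolynomial.induction_on with
  | C a => rw [rename_C, psi_C]
  | add p q hp hq => rw [map_add, map_add, map_add, hp, hq, map_add]
  | mul_X p i hp => rw [map_mul, map_mul, map_mul, hp, rename_X, psi_X_castSucc, ← map_mul]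

/-- **`Ψ (x₃^p − f) = X^p − C f`**: in `ℂ[x₀,x₁,x₂][x₃]` the cyclic cover form is the monic binomial.
[folklore] -/
private theorem psi_cyclicCoverForm (p : ℕ) (f : MvPolynomial (Fin 3) ℂ) : MvPolynomial.optionEquivLeft ℂ (Fin 3)
      (rename finSuccEquivLast (cyclicCoverForm p f)) = Polynomial.X ^ p - Polynomial.C f := by
  rw [cyclicCoverForm_def, map_sub, map_sub, map_pow, map_pow, psi_X_last, psi_rename_castSucc]

/-- **Evaluation through `Ψ`**: `G(x₀,x₁,x₂,t) = ((Ψ G).map ev_x)(t)`. [folklore] -/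
private theorem eval_snoc_eq_eval_map_psi (G : MvPolynomial (Fin 4) ℂ) (x : Fin 3 → ℂ) (t : ℂ) :
    MvPolynomial.eval (Fin.snoc x t : Fin 4 → ℂ) G = Polynomial.eval t (Polynomial.map (MvPolynomial.eval x)
      (MvPolynomial.optionEquivLeft ℂ (Fin 3) (rename finSuccEquivLast G))) := by
  induction G using MvPolynomial.induction_on with
  | C a => rw [MvPolynomial.eval_C, psi_C, Polynomial.map_C, Polynomial.eval_C, MvPolynomial.eval_C]
  | add p q hp hq => rw [map_add, map_add, map_add, Polynomial.map_add, Polynomial.eval_add, hp, hq]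
  | mul_X p i hp =>
    rw [map_mul, MvPolynomial.eval_X, map_mul, map_mul, Polynomial.map_mul, Polynomial.eval_mul, hp]
    congr 1
    induction i using Fin.lastCases with
    | last => rw [Fin.snoc_last, psi_X_last, Polynomial.map_X, Polynomial.eval_X]
    | cast j => rw [Fin.snoc_castSucc, psi_X_castSucc, Polynomial.map_C, Polynomial.eval_C, MvPolynomial.eval_X]

end LastVariable

/-! ### §2 The cyclic cover form of a smooth model is irreducible (`f ≠ 0`) -/

section Irreducible

/-- An irreducible polynomial has positive total degree. [folklore] -/
private theorem one_le_totalDegree_of_irreducible {σ : Type*} {K : Type*} [Field K] {g : MvPolynomial σ K}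
    (hg : Irreducible g) : 1 ≤ g.totalDegree := by
  by_contra hlt
  have h0 : g.totalDegree = 0 := by omega
  rw [totalDegree_eq_zero_iff_eq_C] at h0
  have hc : g.coeff 0 ≠ 0 := by
    intro hc
    apply hg.ne_zero
    rw [h0, hc, map_zero]
  exact hg.not_isUnit (h0 ▸ (Ne.isUnit hc).map C)

variable {p : ℕ} {f : MvPolynomial (Fin 3) ℂ}

/-- The cyclic cover form is homogeneous of degree `p`. [folklore] -/
private theorem isHomogeneous_cyclicCoverForm (hf : f.IsHomogeneous p) : (cyclicCoverForm p f).IsHomogeneous p := by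
  rw [cyclicCoverForm_def]
  exact (isHomogeneous_X_pow (Fin.last 3) p).sub hf.rename_isHomogeneous

/-- Euler: a homogeneous form of positive degree vanishes where all its partials vanish.
[folklore] -/
private theorem eval_eq_zero_of_forall_eval_pderiv_eq_zero (hf : f.IsHomogeneous p) (hp : p ≠ 0) (x : Fin 3 → ℂ)
    (hx : ∀ j, MvPolynomial.eval x (pderiv j f) = 0) : MvPolynomial.eval x f = 0 := by
  have h := congrArg (MvPolynomial.eval x) hf.sum_X_mul_pderiv
  rw [map_sum, map_nsmul, Finset.sum_eq_zero fun j _ ↦ by rw [map_mul, hx j, mul_zero],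
    nsmul_eq_mul] at h
  rcases mul_eq_zero.1 h.symm with h1 | h1
  · exact absurd h1 (Nat.cast_ne_zero.2 hp)
  · exact h1

/-- A homogeneous form of positive degree vanishes at the origin (Euler at `x = 0`). [folklore] -/
private theorem eval_zero_of_isHomogeneous (hf : f.IsHomogeneous p) (hp : p ≠ 0) :
    MvPolynomial.eval (0 : Fin 3 → ℂ) f = 0 := by
  have h := congrArg (MvPolynomial.eval (0 : Fin 3 → ℂ)) hf.sum_X_mul_pderiv
  rw [map_sum, map_nsmul, Finset.sum_eq_zero fun j _ ↦ by
      rw [map_mul, MvPolynomial.eval_X, Pi.zero_apply, zero_mul], nsmul_eq_mul] at h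
  rcases mul_eq_zero.1 h.symm with h1 | h1
  · exact absurd h1 (Nat.cast_ne_zero.2 hp)
  · exact h1

/-- `x₃ ∉ vars (rename castSucc f)`: a form in `x₀,x₁,x₂` does not involve `x₃`. [folklore] -/
private theorem last_notMem_vars_rename_castSucc (f : MvPolynomial (Fin 3) ℂ) :
    Fin.last 3 ∉ (rename Fin.castSucc f : MvPolynomial (Fin 4) ℂ).vars := by
  classical
  intro h
  obtain ⟨i, -, hi⟩ := Finset.mem_image.1 (vars_rename Fin.castSucc f h)
  exact (Fin.castSucc_lt_last i).ne hi

/-- `(Fin.snoc x t) ∘ castSucc = x`. [folklore] -/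
private theorem snoc_comp_castSucc (x : Fin 3 → ℂ) (t : ℂ) : (Fin.snoc x t : Fin 4 → ℂ) ∘ Fin.castSucc = x :=
  funext fun i ↦ Fin.snoc_castSucc (α := fun _ ↦ ℂ) (p := x) (x := t) i

/-- `Fin.snoc x t ≠ 0` when `x ≠ 0`. [folklore] -/
private theorem snoc_ne_zero {x : Fin 3 → ℂ} (hx : x ≠ 0) (t : ℂ) : (Fin.snoc x t : Fin 4 → ℂ) ≠ 0 := by
  intro h0
  apply hx
  funext i
  have := congrFun h0 (Fin.castSucc i)
  rwa [Fin.snoc_castSucc] at this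

/-- The value of the cyclic cover form at `(x, t)`: `F(x,t) = t^p − f(x)`. [folklore] -/
private theorem eval_snoc_cyclicCoverForm (x : Fin 3 → ℂ) (t : ℂ) :
    MvPolynomial.eval (Fin.snoc x t : Fin 4 → ℂ) (cyclicCoverForm p f) = t ^ p - MvPolynomial.eval x f := by
  rw [cyclicCoverForm_def, map_sub, map_pow, MvPolynomial.eval_X, Fin.snoc_last, eval_rename, snoc_comp_castSucc]

/-- `∂F/∂x₃ = p x₃^{p−1}` evaluated at `(x, t)`. [folklore] -/
private theorem eval_snoc_pderiv_last_cyclicCoverForm (x : Fin 3 → ℂ) (t : ℂ) :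
    MvPolynomial.eval (Fin.snoc x t : Fin 4 → ℂ) (pderiv (Fin.last 3) (cyclicCoverForm p f)) =
      (p : ℂ) * t ^ (p - 1) := by
  rw [cyclicCoverForm_def, map_sub, pderiv_pow, pderiv_X_self, mul_one,
    pderiv_eq_zero_of_notMem_vars (last_notMem_vars_rename_castSucc f), sub_zero, map_mul, map_natCast,
    map_pow, MvPolynomial.eval_X, Fin.snoc_last]

/-- `∂F/∂xᵢ = −∂f/∂xᵢ` (`i < 3`) evaluated at `(x, t)`. [folklore] -/
private theorem eval_snoc_pderiv_castSucc_cyclicCoverForm (x : Fin 3 → ℂ) (t : ℂ) (i : Fin 3) :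
    MvPolynomial.eval (Fin.snoc x t : Fin 4 → ℂ) (pderiv (Fin.castSucc i) (cyclicCoverForm p f)) =
      -MvPolynomial.eval x (pderiv i f) := by
  rw [cyclicCoverForm_def, map_sub, pderiv_pow, pderiv_X_of_ne (Fin.castSucc_lt_last i).ne', mul_zero,
    zero_sub, map_neg, pderiv_rename (Fin.castSucc_injective 3), eval_rename, snoc_comp_castSucc]

/-- **The cyclic cover form of a smooth model is irreducible.** For `p ≥ 2`, `f ≠ 0` homogeneous of
degree `p` with `X_F = V₊(F)_red` smooth projective (`F = x₃^p − f`): `X_F` is irreducible, so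
`V₊(F) = V₊(g)` for an irreducible factor `g`, `F = g·h` (Hartshorne I Ex. 2.9); in `ℂ[x₀,x₁,x₂][x₃]`
the binomial `X^p − f` is monic, so the leading coefficients of `g`, `h` in `x₃` are inverse units;
if `h` had positive `x₃`-degree then over every `x ≠ 0` it would have a root `t`, a common zero of
`g` and `h` (every zero of `F` is a zero of `g`), hence a zero of `∂F/∂x₃ = p x₃^{p−1}`: `t = 0` and
`f(x) = t^p = 0` — for all `x`, i.e. `f = 0`. So `h` is a constant unit and `F ∼ g`.
[cite: Hartshorne1977, I Ex. 2.9 and II Ex. 2.9] -/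
private theorem irreducible_cyclicCoverForm (hp : 2 ≤ p) (hf : f.IsHomogeneous p) (hf0 : f ≠ 0)
    (hXF : IsSmoothProjective 2 (SmoothHypersurface.hypersurface (cyclicCoverForm p f))) :
    Irreducible (cyclicCoverForm p f) := by
  letI := MvPolynomial.gradedAlgebra (σ := Fin 4) (R := ℂ)
  have hF : (cyclicCoverForm p f).IsHomogeneous p := isHomogeneous_cyclicCoverForm hf
  have hF0 : cyclicCoverForm p f ≠ 0 := ne_zero_of_isSmoothProjective_hypersurface hXF
  -- the zero locus of `F` is irreducible (image of the irreducible `X_F`)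
  haveI := hXF.geometricallyIrreducible
  haveI : IrreducibleSpace ↥(SmoothHypersurface.hypersurface (cyclicCoverForm p f)).left :=
    AlgebraicGeometry.GeometricallyIrreducible.irreducibleSpace_of_subsingleton
      (SmoothHypersurface.hypersurface (cyclicCoverForm p f)).hom
  have hirrV : IsIrreducible (ProjectiveSpectrum.zeroLocus
      (MvPolynomial.homogeneousSubmodule (Fin 4) ℂ) {cyclicCoverForm p f}) := by
    rw [← SmoothHypersurface.range_hypersurfaceι (cyclicCoverForm p f), ← Set.image_univ]
    exact (IrreducibleSpace.isIrreducible_univ _).image _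
      (SmoothHypersurface.hypersurfaceι (cyclicCoverForm p f)).left.continuous.continuousOn
  obtain ⟨g, hg, ⟨h, hgh⟩, hV⟩ := exists_irreducible_dvd_zeroLocus_eq (cyclicCoverForm p f) hF0 hirrV
  have hgdeg : g.IsHomogeneous g.totalDegree :=
    Literature.NumberTheory.Transcendental.Roy2013.isHomogeneous_of_dvd hF hF0 ⟨h, hgh⟩
  have hd' : 1 ≤ g.totalDegree := one_le_totalDegree_of_irreducible hg
  -- every non-zero zero of `F` is a zero of `g`
  have hzero : ∀ z : Fin 4 → ℂ, z ≠ 0 → MvPolynomial.eval z (cyclicCoverForm p f) = 0 →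
      MvPolynomial.eval z g = 0 := by
    intro z hz hFz
    have h1 : (ProjectiveSpace.pointOfVec ℂ z hz).pt ∈
        ProjectiveSpectrum.zeroLocus (MvPolynomial.homogeneousSubmodule (Fin 4) ℂ) {cyclicCoverForm p f} :=
      (ProjectiveSpace.pt_pointOfVec_mem_zeroLocus_iff z hz (by omega : 0 < p) hF).2
        (by rw [MvPolynomial.aeval_eq_eval]; exact hFz)
    rw [← hV] at h1
    have h2 := (ProjectiveSpace.pt_pointOfVec_mem_zeroLocus_iff z hz (by omega : 0 < g.totalDegree)
      hgdeg).1 h1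
    rwa [MvPolynomial.aeval_eq_eval] at h2
  -- in `ℂ[y][x₃]`: `Ψ g * Ψ h = X^p − C f` is monic
  set G := MvPolynomial.optionEquivLeft ℂ (Fin 3) (rename finSuccEquivLast g) with hGdef
  set H := MvPolynomial.optionEquivLeft ℂ (Fin 3) (rename finSuccEquivLast h) with hHdef
  have hGH : G * H = Polynomial.X ^ p - Polynomial.C f := by
    rw [hGdef, hHdef, ← map_mul, ← map_mul, ← hgh, psi_cyclicCoverForm]
  have hlc : G.leadingCoeff * H.leadingCoeff = 1 := by
    rw [← Polynomial.leadingCoeff_mul, hGH]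
    exact (Polynomial.monic_X_pow_sub_C f (by omega)).leadingCoeff
  -- Step 1: `h` has `x₃`-degree `0`
  have hH0 : H.natDegree = 0 := by
    by_contra hne
    apply hf0
    refine MvPolynomial.funext fun x ↦ ?_
    rw [map_zero]
    by_cases hx : x = 0
    · rw [hx]
      exact eval_zero_of_isHomogeneous hf (by omega)
    -- the specialisation `H_x = H(x₀,x₁,x₂; X)` has a root `t`
    have hlcx : MvPolynomial.eval x H.leadingCoeff ≠ 0 := by
      intro h0
      have h1 := congrArg (MvPolynomial.eval x) hlc
      rw [map_mul, h0, mul_zero, map_one] at h1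
      exact zero_ne_one h1
    have hdeg : (H.map (MvPolynomial.eval x)).natDegree = H.natDegree :=
      Polynomial.natDegree_map_of_leadingCoeff_ne_zero _ hlcx
    have hne0 : H.map (MvPolynomial.eval x) ≠ 0 := by
      intro h0
      rw [h0, Polynomial.natDegree_zero] at hdeg
      exact hne hdeg.symm
    obtain ⟨t, ht⟩ := IsAlgClosed.exists_root (H.map (MvPolynomial.eval x)) (by
      rw [Polynomial.degree_eq_natDegree hne0, hdeg]
      exact_mod_cast hne)
    -- `z = (x, t)` is a common zero of `h`, `F`, `g`, hence of `∂F/∂x₃ = p x₃^{p−1}`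
    have hz : (Fin.snoc x t : Fin 4 → ℂ) ≠ 0 := snoc_ne_zero hx t
    have hhz : MvPolynomial.eval (Fin.snoc x t : Fin 4 → ℂ) h = 0 := by
      rw [eval_snoc_eq_eval_map_psi]; exact ht
    have hFz : MvPolynomial.eval (Fin.snoc x t : Fin 4 → ℂ) (cyclicCoverForm p f) = 0 := by
      rw [hgh, map_mul, hhz, mul_zero]
    have hgz : MvPolynomial.eval (Fin.snoc x t : Fin 4 → ℂ) g = 0 := hzero _ hz hFz
    have hdF : MvPolynomial.eval (Fin.snoc x t : Fin 4 → ℂ) (pderiv (Fin.last 3) (cyclicCoverForm p f)) = 0 := by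
      rw [hgh, pderiv_mul, map_add, map_mul, map_mul, hgz, hhz, mul_zero, zero_mul, add_zero]
    rw [eval_snoc_pderiv_last_cyclicCoverForm] at hdF
    have ht0 : t = 0 := by
      rcases mul_eq_zero.1 hdF with h1 | h1
      · exact absurd h1 (Nat.cast_ne_zero.2 (by omega))
      · exact (pow_eq_zero_iff (by omega : p - 1 ≠ 0)).1 h1
    rw [eval_snoc_cyclicCoverForm, ht0, zero_pow (by omega), zero_sub, neg_eq_zero] at hFz
    exact hFz
  -- Step 2: `h` is a (constant) unit, so `F = g·h` is irreducible
  have hHu : IsUnit H := by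
    rw [Polynomial.eq_C_of_natDegree_eq_zero hH0, Polynomial.isUnit_C]
    have hlc' : H.leadingCoeff = H.coeff 0 := by rw [Polynomial.leadingCoeff, hH0]
    rw [← hlc']
    exact IsUnit.of_mul_eq_one_right _ hlc
  have hhu : IsUnit h := by
    have h1 : IsUnit (rename finSuccEquivLast h : MvPolynomial (Option (Fin 3)) ℂ) := by
      have h2 := hHu.map (MvPolynomial.optionEquivLeft ℂ (Fin 3)).symm
      rwa [hHdef, AlgEquiv.symm_apply_apply] at h2
    have h3 := h1.map (MvPolynomial.renameEquiv ℂ (finSuccEquivLast (n := 3))).symm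
    rwa [show (rename finSuccEquivLast h : MvPolynomial (Option (Fin 3)) ℂ) =
        MvPolynomial.renameEquiv ℂ finSuccEquivLast h from rfl, AlgEquiv.symm_apply_apply] at h3
  rw [hgh]
  exact (irreducible_mul_isUnit hhu).2 hg

end Irreducible

/-! ### §3 Smooth cyclic covers have smooth branch curves: the Jacobian direction -/

section Jacobian

variable {p : ℕ} {f : MvPolynomial (Fin 3) ℂ}

/-- **If `X_F` (`F = x₃^p − f`, `f ≠ 0`, `p ≥ 2`) is smooth projective, the partial derivatives of `f`
have no common non-trivial zero** (so the Jacobian ring `R_f` is Artinian). At a common zero `x ≠ 0`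
of the `∂f/∂xᵢ`, Euler gives `f(x) = 0`, so `z = (x, 0)` is a non-zero zero of the IRREDUCIBLE form
`F` (`irreducible_cyclicCoverForm`) with `∇F(z) = (−∇f(x), p·0^{p−1}) = 0`, contradicting the
Jacobian criterion for the smooth hypersurface `X_F` (the tree's
`Hartshorne1977_smoothHypersurface_jacobian_holds`).
[cite: Hartshorne1977, I Thm. 5.1 and Ex. 5.8; III Example 10.0.3]
[cite: VoisinHodgeII2003, §6.2.2 before Def. 6.18 (held text chunk p0165)] -/
private theorem eq_zero_of_forall_eval_pderiv_eq_zero (hp : 2 ≤ p) (hf : f.IsHomogeneous p) (hf0 : f ≠ 0)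
    (hXF : IsSmoothProjective 2 (SmoothHypersurface.hypersurface (cyclicCoverForm p f)))
    (x : Fin 3 → ℂ) (hx : ∀ j, MvPolynomial.eval x (pderiv j f) = 0) : x = 0 := by
  by_contra hx0
  have hF : (cyclicCoverForm p f).IsHomogeneous p := isHomogeneous_cyclicCoverForm hf
  have hirr : Irreducible (cyclicCoverForm p f) := irreducible_cyclicCoverForm hp hf hf0 hXF
  have hz : (Fin.snoc x 0 : Fin 4 → ℂ) ≠ 0 := snoc_ne_zero hx0 0
  have hfx : MvPolynomial.eval x f = 0 := eval_eq_zero_of_forall_eval_pderiv_eq_zero hf (by omega) x hx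
  have hFz : MvPolynomial.eval (Fin.snoc x 0 : Fin 4 → ℂ) (cyclicCoverForm p f) = 0 := by
    rw [eval_snoc_cyclicCoverForm, hfx, zero_pow (by omega), sub_zero]
  obtain ⟨j, hj⟩ := Hartshorne1977_smoothHypersurface_jacobian_holds 2 p
    (SmoothHypersurface.hypersurface (cyclicCoverForm p f)) (cyclicCoverForm p f) hXF hF hirr
    (SmoothHypersurface.isHypersurfaceCutOutBy_self (cyclicCoverForm p f)) (Fin.snoc x 0) hz hFz
  apply hj
  induction j using Fin.lastCases with
  | last => rw [eval_snoc_pderiv_last_cyclicCoverForm, zero_pow (by omega), mul_zero]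
  | cast i => rw [eval_snoc_pderiv_castSucc_cyclicCoverForm, hx i, neg_zero]

end Jacobian

/-! ### §4 The cyclic cover form of a smooth model is a nonsingular form -/

section Nonsingular

variable {p : ℕ} {f : MvPolynomial (Fin 3) ℂ}

/-- **For a smooth model `X_F`, `F = x₃^p − f` (`f ≠ 0` homogeneous of degree `p ≥ 2`), the gradient of `F`
vanishes at no non-zero zero of `F`** (the tree's Jacobian criterion
`Hartshorne1977_smoothHypersurface_jacobian_holds` for the irreducible form `F`).
[cite: Hartshorne1977, I Thm. 5.1 and Ex. 5.8] -/
theorem exists_eval_pderiv_cyclicCoverForm_ne_zero (hp : 2 ≤ p) (hf : f.IsHomogeneous p) (hf0 : f ≠ 0)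
    (hXF : IsSmoothProjective 2 (SmoothHypersurface.hypersurface (cyclicCoverForm p f)))
    (z : Fin 4 → ℂ) (hz : z ≠ 0) (hFz : MvPolynomial.eval z (cyclicCoverForm p f) = 0) :
    ∃ j, MvPolynomial.eval z (MvPolynomial.pderiv j (cyclicCoverForm p f)) ≠ 0 :=
  Hartshorne1977_smoothHypersurface_jacobian_holds 2 p (SmoothHypersurface.hypersurface (cyclicCoverForm p f))
    (cyclicCoverForm p f) hXF (isHomogeneous_cyclicCoverForm hf) (irreducible_cyclicCoverForm hp hf hf0 hXF)
    (SmoothHypersurface.isHypersurfaceCutOutBy_self (cyclicCoverForm p f)) z hz hFz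

/-- **The cyclic cover form of a smooth model is a nonsingular form**: for `f ≠ 0` homogeneous of degree
`p ≥ 2` with `X_F` smooth projective, `F = x₃^p − f` is a nonsingular form in the tree's (prime-ideal) sense
`SmoothHypersurface.IsNonsingularForm` — so `[F]` is a point of the open set `U` of nonsingular forms
(`UniversalHypersurface.baseOpens`). Jacobian criterion + Hilbert's Nullstellensatz
(`isNonsingularForm_of_forall_exists_eval_pderiv_ne_zero`). [cite: Hartshorne1977, I Thm. 5.1 and Ex. 5.8] -/
theorem isNonsingularForm_cyclicCoverForm_of_isSmoothProjective (hp : 2 ≤ p) (hf : f.IsHomogeneous p)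
    (hf0 : f ≠ 0) (hXF : IsSmoothProjective 2 (SmoothHypersurface.hypersurface (cyclicCoverForm p f))) :
    SmoothHypersurface.IsNonsingularForm ℂ (cyclicCoverForm p f) :=
  SmoothHypersurface.isNonsingularForm_of_forall_exists_eval_pderiv_ne_zero
    (exists_eval_pderiv_cyclicCoverForm_ne_zero hp hf hf0 hXF)

/-- The cyclic cover form is homogeneous of degree `p` (public restatement for the consumers of this file).
[cite: CarlsonToledo1999, §2 (universalcyclic) (held text p0004)] -/
theorem isHomogeneous_cyclicCoverForm_of_isHomogeneous (hf : f.IsHomogeneous p) :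
    (cyclicCoverForm p f).IsHomogeneous p :=
  isHomogeneous_cyclicCoverForm hf

/-- The value of the cyclic cover form at `(x, t)`: `F(x,t) = t^p − f(x)` (public restatement).
[cite: CarlsonToledo1999, §2 (universalcyclic) (held text p0004)] -/
theorem eval_snoc_cyclicCoverForm_eq (x : Fin 3 → ℂ) (t : ℂ) :
    MvPolynomial.eval (Fin.snoc x t : Fin 4 → ℂ) (cyclicCoverForm p f) = t ^ p - MvPolynomial.eval x f :=
  eval_snoc_cyclicCoverForm x t

/-- **`x₃^p` alone is NOT a nonsingular form for `p ≥ 2`** (the model with `f = 0` is the `p`-fold plane,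
singular as a form: `∇(x₃^p) = (0,0,0,p x₃^{p−1})` vanishes at `(1,0,0,0) ∈ V(x₃^p)`); so the points of the
Carlson–Toledo base classify NON-ZERO branch forms. [cite: Hartshorne1977, I Ex. 5.8] -/
theorem not_isNonsingularForm_cyclicCoverForm_zero (hp : 2 ≤ p) :
    ¬ SmoothHypersurface.IsNonsingularForm ℂ (cyclicCoverForm p 0) := by
  rw [SmoothHypersurface.isNonsingularForm_iff_forall_exists_eval_pderiv_ne_zero]
  intro h
  have hz : (Fin.snoc (Pi.single 0 1 : Fin 3 → ℂ) 0 : Fin 4 → ℂ) ≠ 0 :=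
    snoc_ne_zero (by intro h0; simpa using congrFun h0 0) 0
  obtain ⟨j, hj⟩ := h _ hz (by rw [eval_snoc_cyclicCoverForm, map_zero, sub_zero, zero_pow (by omega)])
  apply hj
  induction j using Fin.lastCases with
  | last => rw [eval_snoc_pderiv_last_cyclicCoverForm, zero_pow (by omega), mul_zero]
  | cast i => rw [eval_snoc_pderiv_castSucc_cyclicCoverForm, map_zero, map_zero, neg_zero]

end Nonsingular

end CyclicCoverFormNonsingular

end Literature.AlgebraicGeometry.HodgeTheory

end
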